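import Summits.QuantumFields.YangMills.Theorems.BalabanUVNodesPortS1Sect4WardRows
import Summits.QuantumFields.YangMills.Theorems.BalabanUVNodesK0PortChart44DAtRecord

/-!
# NODE O port PT-A (second hand), [RG-I] §4 (4.7)–(4.15) AT THE RECORD, part 2 — (1.19) ⟹ (4.14) on print's SCALED (4.4)-domain `Chart44D`, generic and at
# the record's names (both chart editions): the Ward mould `FormatPlusW` for the SAME pieces from 27930's (1.19)-mould and 27932's chart row

Cell `ym-nodeO-ideate` ∕ programme cell `ym-balaban-port`, porter seat `ymgap-nodeO-port-PTA-2` (gen 0), PORT item `stmt-QuantumFields-27930`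
`PortRecordRepresentationS1`, PORT-PLAN row **S4-B** ([I] §4 (4.13)–(4.14) p. 284); `--supports stmt-QuantumFields-27930 --as helper` (count-neutral).
[I] = [Balaban1987RG1] (CMP **109** (1987) 249–301; held `paper:balaban1987-cmp109-rg-i-small-field`, journal page = PDF page + 248).  Part 1 =
`BalabanUVNodesPortS1Sect4WardRows` (the record's rows `noInvariantCovectorAt(J)`, `chartEquivariantAt(J)`).

WHAT IS PRINTED (verbatim, p. 284).  *"(4.13). For constant λ we get ⟨(δ∕δB)𝐄(1), i ad_λ B₁⟩ = 0, and since the configuration B₁ is arbitrary, we get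
[λ, (δ∕δB)𝐄(1)] = 0 for all λ ∈ 𝔤ᶜ. The group G is semisimple, hence this is possible only for the element 0 in the algebra 𝔤ᶜ. Thus we have the first,
very important consequence of the gauge invariance (δ∕δB)𝐄(1) = 0. (4.14) This equality simplifies the identities, and also the sum (4.6), we can drop
the term with n = 1."*; p. 290: *"For n = 2, and by the identity (4.14), the formula (4.3) yields … (4.35)"*.

WHAT IS TYPED HERE.
* §4 `ward414_of_gaugeInv119_chart44D` ∕ `formatPlusW_of_formatPlusG_chart44D` ∕ `rows_for_435_chart44D` — print's three lines (4.13) ⟹ (4.14) for charted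
  pieces, GENERIC, with the chart obligation on a NAMED domain (typer-1's `B12FormatPlus.Chart44D`, v5) in place of the polydisc `Chart44` of typer-1's v3
  `ward414_of_gaugeInv119` ∕ `formatPlusW_of_formatPlusG` ∕ `FormatPlusW.rows_for_435` (the cell's located repair R-O2: a k-uniform polydisc is not granted at
  the record; (4.4) p. 281 is a convex balanced neighbourhood in ξ-scaled norms).  Proofs = typer-1's, reading `0 ∈ D`, analyticity on `D`, `χ(D) ⊆ U^c`.
* §5 ★ `formatPlusW_of_formatPlusG_recordJ` ∕ `formatPlusW_of_formatPlusG_record` — (1.19) ⟹ (4.14) AT THE RECORD: `FormatPlusG` over the record families at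
  the volumes `K₀ + n` (27930's consequent shape; two-block chart `recordChartJ` of the (R-J) edition, resp. the v1 chart `recordChart`) ∧ `Chart44D` on
  `recordDom44J … α₂` (resp. `recordDom44`) (27932's consequent shape) ⟹ `FormatPlusW` for the SAME pieces — generic in the functional, the embedding and the
  two-volume data, so it serves the signed texts verbatim whatever `θ`, `K₀`; by part 1's `noInvariantCovectorAtJ` ∕ `chartEquivariantAtJ`.  Receipt forms
  `formatPlusWAtJ_of_formatPlusGAtJ` ∕ `formatPlusWAt_of_formatPlusGAt` at DEF-1's elaboration receipts (unshifted families).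
So on the port's road the Ward row (4.14) costs NOTHING beyond 27930 ∧ 27932.

HONEST FRAMING.  Bookkeeping; the (4.14) consequence is CONDITIONAL on the (1.19)-mould and the chart row — the consequents of the OPEN items 27930 ∕ 27932 —
taken as hypotheses; nothing of Bałaban's estimates is asserted, ported or discharged; 27930 stays OPEN; K0⁷ NOT closed; NODE O 0∕1; COUNT 8∕28 · K 1∕4
UNMOVED; finite `𝕋⁴_{L^K}` at fixed ε — NOT continuum ∕ OS ∕ Clay; **the Yang–Mills mass gap is NOT proved by any of this.**  No `sorry`, no `def`, no
`instance`; standard axioms.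
-/

noncomputable section

open scoped BigOperators Matrix.Norms.L2Operator Topology

namespace Summit.QuantumFields.YangMills.Theorems.BalabanUVNodesPortS1

open Summit.QuantumFields.YangMills.Theorems.K0RecordFormatNames
open Literature.MathematicalPhysics.QuantumFieldTheory.Balaban1983to89
open Literature.MathematicalPhysics.QuantumFieldTheory.Balaban1983to89.Node00
open Literature.MathematicalPhysics.QuantumFieldTheory.Balaban1983to89.T4Continuum (T4Family)
open NormedSpace (exp)
open _root_.Filter

variable (F : T4Family)

/-! ## §4  (1.19) ⟹ (4.14) ON A NAMED DOMAIN — print's (4.13)–(4.14) three lines, for charts obeying (4.4) in its SCALED form `Chart44D` (the cell's located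
repair R-O2: a k-uniform polydisc `Chart44` is not granted at the record; typer-1's v3 `ward414_of_gaugeInv119` is its polydisc special case) -/

section WardD

variable {S : ℕ → LocDomainSys} {M m : ℕ → ℕ}

/-- **(1.19) + an equivariant chart analytic on a (4.4)-domain + (1.9) analyticity + «G semisimple» ⟹ (4.14)** `D(𝐄(X, ·) ∘ χ_X)(0) = 0`, per charted piece:
print p.284's derivation, with the chart obligation on the NAMED domain `D n X` (`0 ∈ D`, `χ` analytic on `D`, `χ(D) ⊆ U^c`) in place of a polydisc.
[cite: Balaban1987RG1, (1.19) p.263, (4.4) p.281, (4.13)–(4.14) p.284] -/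
theorem ward414_of_gaugeInv119_chart44D {H G : ℕ → Type*} {toG : (n : ℕ) → H n → G n}
    {act : (n : ℕ) → G n → (Fin (M n) → ℂ) → (Fin (M n) → ℂ)} {Uc : (n : ℕ) → (S n).Dom → Set (Fin (M n) → ℂ)} {E : B12FormatPlus.Pieces S M}
    {χ : (n : ℕ) → (S n).Dom → (Fin (m n) → ℂ) → (Fin (M n) → ℂ)} {A : (n : ℕ) → H n → ((Fin (m n) → ℂ) →L[ℂ] (Fin (m n) → ℂ))}
    {D : (n : ℕ) → (S n).Dom → Set (Fin (m n) → ℂ)}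
    (hG : B12FormatPlus.GaugeInv119 act Uc E) (hχ : B12FormatPlus.ChartEquivariant toG act χ A) (hC : B12FormatPlus.Chart44D S M Uc m χ D)
    (hA : B12FormatPlus.Analytic19 Uc E) (hN : ∀ n, B12FormatPlus.NoInvariantCovector (A n)) : B12FormatPlus.Ward414 χ E := by
  intro n X
  refine B12FormatPlus.fderiv_eq_zero_of_invariant_noFixedCovector (A n) (fun g => Eventually.of_forall fun v => ?_) ?_ (hN n)
  · show E n X (χ n X (A n g v)) = E n X (χ n X v)
    rw [hχ n X g v, hG.2 n (toG n g) X]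
  · obtain ⟨-, -, -, h0, hχan, hmaps⟩ := hC n X
    exact ((hA n X (χ n X 0) (hmaps h0)).comp (hχan 0 h0)).differentiableAt

variable {Uc : (n : ℕ) → (S n).Dom → Set (Fin (M n) → ℂ)} {coords : (n : ℕ) → (S n).Dom → Finset (Fin (M n))}
  {χ : (n : ℕ) → (S n).Dom → (Fin (m n) → ℂ) → (Fin (M n) → ℂ)} {W : ℕ → Type*} {tW : ∀ n, TopologicalSpace (W n)} {zW : ∀ n, Zero (W n)}
  {Φf : (n : ℕ) → W n → ℂ} {ι : (n : ℕ) → W n → (Fin (m n) → ℂ)} {wrap : (n : ℕ) → Finset (S n).Dom}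
  {emb : (n : ℕ) → (S n).Dom → (S (n + 1)).Dom} {πc : (n : ℕ) → (S n).Dom → (Fin (M (n + 1)) → ℂ) → (Fin (M n) → ℂ)} {E₀ κ : ℝ}
  {D : (n : ℕ) → (S n).Dom → Set (Fin (m n) → ℂ)}

/-- **(1.19)-mould + equivariant chart on a (4.4)-domain + no invariant covector ⟹ Ward-mould, for the SAME pieces** (typer-1's `formatPlusW_of_formatPlusG`
with `Chart44D` in place of the polydisc `Chart44`). [cite: Balaban1987RG1, (1.19) p.263, (4.4) p.281, (4.13)–(4.14) p.284] -/
theorem formatPlusW_of_formatPlusG_chart44D {H G : ℕ → Type*} {toG : (n : ℕ) → H n → G n}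
    {act : (n : ℕ) → G n → (Fin (M n) → ℂ) → (Fin (M n) → ℂ)} {A : (n : ℕ) → H n → ((Fin (m n) → ℂ) →L[ℂ] (Fin (m n) → ℂ))}
    (h : B12FormatPlus.FormatPlusG S M act Uc coords m χ Φf ι wrap emb πc E₀ κ) (hχ : B12FormatPlus.ChartEquivariant toG act χ A)
    (hC : B12FormatPlus.Chart44D S M Uc m χ D) (hN : ∀ n, B12FormatPlus.NoInvariantCovector (A n)) :
    B12FormatPlus.FormatPlusW S M Uc coords m χ Φf ι wrap emb πc E₀ κ := by
  obtain ⟨E, hA, hB, hL, hR, hV, hG⟩ := h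
  exact ⟨E, hA, hB, hL, hR, hV, ward414_of_gaugeInv119_chart44D hG hχ hC hA hN⟩

/-- The Ward mould + the chart on a (4.4)-domain hand, for the SAME pieces: pieces∘chart `C²` at `0` (indeed analytic near `0 ∈ D`), locality, the (S1)
neighbourhood, the two-volume identity, AND (4.14) — the binder list the (4.35) p.290 bridge consumes (typer-1's `FormatPlusW.rows_for_435` on `D`).
[cite: Balaban1987RG1, (1.6)–(1.7) p.261, (4.4) p.281, (4.14) p.284, (4.35) p.290 (bookkeeping)] -/
theorem rows_for_435_chart44D (h : B12FormatPlus.FormatPlusW S M Uc coords m χ Φf ι wrap emb πc E₀ κ) (hC : B12FormatPlus.Chart44D S M Uc m χ D) :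
    ∃ E : B12FormatPlus.Pieces S M,
      (∀ n X, ContDiffAt ℂ 2 (fun u => E n X (χ n X u)) 0) ∧ B12FormatPlus.Local17 coords E ∧
      (∀ n, ∃ U ∈ 𝓝 (0 : W n), ∀ B ∈ U, Φf n B = ∑ X : (S n).Dom, E n X (χ n X (ι n B))) ∧
      B12FormatPlus.PieceVolIndep S M wrap emb πc E ∧ B12FormatPlus.Ward414 χ E := by
  obtain ⟨E, hA, hB, hL, hR, hV, hW⟩ := h
  refine ⟨E, fun n X => ?_, hL, fun n => hR.exists_nhds n, hV, hW⟩
  obtain ⟨-, -, -, h0, hχan, hmaps⟩ := hC n X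
  exact ((hA n X (χ n X 0) (hmaps h0)).comp (hχan 0 h0)).contDiffAt

end WardD

/-! ## §5  ★ (4.14) AT THE RECORD: the (1.19)-mould of 27930 and the chart row of 27932 give the Ward mould for the SAME pieces — both chart editions,
at any volume offset `K₀` (the texts read `K₀ := recordK₀ F Mc k`), for any functional ∕ embedding ∕ two-volume data -/

/-- **★ (1.19) ⟹ (4.14) AT THE RECORD, two-block chart** — for the record's catalogue, coordinates, action, spaces and the two-block chart `recordChartJ` at the
volumes `K₀ + n`: `FormatPlusG` (27930⁷'s consequent shape) ∧ `Chart44D` on `recordDom44J … α₂` (27932⁗'s consequent shape) ⟹ `FormatPlusW` — (4.14)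
`D(𝐄^{(j)}(X, ·) ∘ χ_X)(0) = 0` for the same pieces; by §2 (`noInvariantCovectorAtJ`) and §3 (`chartEquivariantAtJ`).  Generic in the functional, the
embedding and the two-volume data, so it serves the signed texts verbatim. [cite: Balaban1987RG1, (1.19) p.263, (4.4) p.281, (4.8) p.283, (4.13)–(4.14) p.284] -/
theorem formatPlusW_of_formatPlusG_recordJ (Mc k K₀ : ℕ) (α₀ α₁ α₂ E₀ κ : ℝ)
    {W : ℕ → Type*} {tW : ∀ n, TopologicalSpace (W n)} {zW : ∀ n, Zero (W n)} {Φf : (n : ℕ) → W n → ℂ}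
    {ι : (n : ℕ) → W n → (Fin (recordChartDimJ F (K₀ + n)) → ℂ)}
    {wrap : (n : ℕ) → Finset (recordDomSys F Mc k (K₀ + n)).Dom}
    {emb : (n : ℕ) → (recordDomSys F Mc k (K₀ + n)).Dom → (recordDomSys F Mc k (K₀ + (n + 1))).Dom}
    {πc : (n : ℕ) → (recordDomSys F Mc k (K₀ + n)).Dom → (Fin (recordBondCount F (K₀ + (n + 1))) → ℂ) → (Fin (recordBondCount F (K₀ + n)) → ℂ)}
    (hG : B12FormatPlus.FormatPlusG (fun n => recordDomSys F Mc k (K₀ + n)) (fun n => recordBondCount F (K₀ + n)) (fun n => recordAct F (K₀ + n))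
      (fun n => recordUc F Mc k α₀ α₁ (K₀ + n)) (fun n => recordCoords F Mc k (K₀ + n)) (fun n => recordChartDimJ F (K₀ + n))
      (fun n => recordChartJ F Mc k (K₀ + n)) Φf ι wrap emb πc E₀ κ)
    (hC : B12FormatPlus.Chart44D (fun n => recordDomSys F Mc k (K₀ + n)) (fun n => recordBondCount F (K₀ + n)) (fun n => recordUc F Mc k α₀ α₁ (K₀ + n))
      (fun n => recordChartDimJ F (K₀ + n)) (fun n => recordChartJ F Mc k (K₀ + n)) (fun n X => recordDom44J F Mc k (K₀ + n) X α₂)) :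
    B12FormatPlus.FormatPlusW (fun n => recordDomSys F Mc k (K₀ + n)) (fun n => recordBondCount F (K₀ + n))
      (fun n => recordUc F Mc k α₀ α₁ (K₀ + n)) (fun n => recordCoords F Mc k (K₀ + n)) (fun n => recordChartDimJ F (K₀ + n))
      (fun n => recordChartJ F Mc k (K₀ + n)) Φf ι wrap emb πc E₀ κ :=
  formatPlusW_of_formatPlusG_chart44D (toG := fun n => recordToG F (K₀ + n)) (A := fun n => recordAdJ F (K₀ + n)) hG
    (fun n X g u => chartEquivariantAtJ F Mc k (K₀ + n) X g u) hC fun n => noInvariantCovectorAtJ F (K₀ + n)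

/-- **★ (1.19) ⟹ (4.14) AT THE RECORD, v1 chart** — the same over the one-block exp-chart `recordChart` and its domain `recordDom44` (the J-free edition of the
names; kept as the variant the append-only names file keeps). [cite: Balaban1987RG1, (1.19) p.263, (4.4) p.281, (4.8) p.283, (4.13)–(4.14) p.284] -/
theorem formatPlusW_of_formatPlusG_record (Mc k K₀ : ℕ) (α₀ α₁ α₂ E₀ κ : ℝ)
    {W : ℕ → Type*} {tW : ∀ n, TopologicalSpace (W n)} {zW : ∀ n, Zero (W n)} {Φf : (n : ℕ) → W n → ℂ}
    {ι : (n : ℕ) → W n → (Fin (recordChartDim F (K₀ + n)) → ℂ)}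
    {wrap : (n : ℕ) → Finset (recordDomSys F Mc k (K₀ + n)).Dom}
    {emb : (n : ℕ) → (recordDomSys F Mc k (K₀ + n)).Dom → (recordDomSys F Mc k (K₀ + (n + 1))).Dom}
    {πc : (n : ℕ) → (recordDomSys F Mc k (K₀ + n)).Dom → (Fin (recordBondCount F (K₀ + (n + 1))) → ℂ) → (Fin (recordBondCount F (K₀ + n)) → ℂ)}
    (hG : B12FormatPlus.FormatPlusG (fun n => recordDomSys F Mc k (K₀ + n)) (fun n => recordBondCount F (K₀ + n)) (fun n => recordAct F (K₀ + n))
      (fun n => recordUc F Mc k α₀ α₁ (K₀ + n)) (fun n => recordCoords F Mc k (K₀ + n)) (fun n => recordChartDim F (K₀ + n))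
      (fun n => recordChart F Mc k (K₀ + n)) Φf ι wrap emb πc E₀ κ)
    (hC : B12FormatPlus.Chart44D (fun n => recordDomSys F Mc k (K₀ + n)) (fun n => recordBondCount F (K₀ + n)) (fun n => recordUc F Mc k α₀ α₁ (K₀ + n))
      (fun n => recordChartDim F (K₀ + n)) (fun n => recordChart F Mc k (K₀ + n)) (fun n X => recordDom44 F Mc k (K₀ + n) X α₂)) :
    B12FormatPlus.FormatPlusW (fun n => recordDomSys F Mc k (K₀ + n)) (fun n => recordBondCount F (K₀ + n))
      (fun n => recordUc F Mc k α₀ α₁ (K₀ + n)) (fun n => recordCoords F Mc k (K₀ + n)) (fun n => recordChartDim F (K₀ + n))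
      (fun n => recordChart F Mc k (K₀ + n)) Φf ι wrap emb πc E₀ κ :=
  formatPlusW_of_formatPlusG_chart44D (toG := fun n => recordToG F (K₀ + n)) (A := fun n => recordAd F (K₀ + n)) hG
    (fun n X g u => chartEquivariantAt F Mc k (K₀ + n) X g u) hC fun n => noInvariantCovectorAt F (K₀ + n)

/-- **The receipts, two-block edition**: DEF-1's elaboration receipts `FormatPlusGAtJ` ((1.19)-vehicle of 27930) and `Chart44DAtJ` (27932) give `FormatPlusWAtJ`
(the Ward-vehicle body) at the same letters — unshifted family (`K₀ = 0` up to `Nat.zero_add`, stated directly). [cite: Balaban1987RG1, (4.14) p.284 (bookkeeping)] -/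
theorem formatPlusWAtJ_of_formatPlusGAtJ (Mc k : ℕ) (a₀ ε₂₉ α₀ α₁ α₂ E₀ κ : ℝ) (v : Fin (k + 1) → ℝ)
    (hG : FormatPlusGAtJ F Mc k a₀ ε₂₉ α₀ α₁ E₀ κ v) (hC : Chart44DAtJ F Mc k α₀ α₁ α₂) : FormatPlusWAtJ F Mc k a₀ ε₂₉ α₀ α₁ E₀ κ v :=
  formatPlusW_of_formatPlusG_chart44D (toG := recordToG F) (A := recordAdJ F) hG (chartEquivariantAtJ F Mc k) hC (noInvariantCovectorAtJ F)

/-- **The receipts, v1 edition**: `FormatPlusGAt` and `Chart44DAt` give `FormatPlusWAt`. [cite: Balaban1987RG1, (4.14) p.284 (bookkeeping)] -/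
theorem formatPlusWAt_of_formatPlusGAt (Mc k : ℕ) (a₀ ε₂₉ α₀ α₁ α₂ E₀ κ : ℝ) (v : Fin (k + 1) → ℝ)
    (hG : FormatPlusGAt F Mc k a₀ ε₂₉ α₀ α₁ E₀ κ v) (hC : Chart44DAt F Mc k α₀ α₁ α₂) : FormatPlusWAt F Mc k a₀ ε₂₉ α₀ α₁ E₀ κ v :=
  formatPlusW_of_formatPlusG_chart44D (toG := recordToG F) (A := recordAd F) hG (chartEquivariantAt F Mc k) hC (noInvariantCovectorAt F)

/-! ## §6  (v2 APPEND, after the CLOSE of PT-C 27932 by `K0PortChart44DAtRecord.portRowE118U2_sig` and its volume-shifted row `chart44DJ_record`):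
★ the chart hypothesis DISCHARGED — at the record, for every `α₀, α₁ > 0`, the (1.19)-mould ALONE gives the Ward mould (4.14) for the SAME pieces -/

/-- **★ (1.19) ⟹ (4.14) AT THE RECORD, UNCONDITIONALLY IN THE CHART** — two-block chart `recordChartJ` on the shifted volumes `recordK₀ F Mc k + n`, ANY
functional ∕ embedding ∕ two-volume data: `FormatPlusG … E₀ κ → FormatPlusW … E₀ κ` for `0 < α₀`, `0 < α₁` — §5's `formatPlusW_of_formatPlusG_recordJ` with
the chart row supplied BY NAME from the closed item 27932 (`K0PortChart44DAtRecord.chart44DJ_record`, `α₂ = min ¼ (min α₁ (α₀∕36))`).  So the Ward twin of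
the signed text 27930⁷ (and of its ⁸ re-cut: same consequent shape) follows from the text itself. [cite: Balaban1987RG1, (1.19) p.263, (4.4) p.281, (4.13)–(4.14) p.284] -/
theorem formatPlusW_of_formatPlusG_recordJ_K₀ (Mc k : ℕ) {α₀ α₁ : ℝ} (hα₀ : 0 < α₀) (hα₁ : 0 < α₁) (E₀ κ : ℝ)
    {W : ℕ → Type*} {tW : ∀ n, TopologicalSpace (W n)} {zW : ∀ n, Zero (W n)} {Φf : (n : ℕ) → W n → ℂ}
    {ι : (n : ℕ) → W n → (Fin (recordChartDimJ F (recordK₀ F Mc k + n)) → ℂ)}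
    {wrap : (n : ℕ) → Finset (recordDomSys F Mc k (recordK₀ F Mc k + n)).Dom}
    {emb : (n : ℕ) → (recordDomSys F Mc k (recordK₀ F Mc k + n)).Dom → (recordDomSys F Mc k (recordK₀ F Mc k + (n + 1))).Dom}
    {πc : (n : ℕ) → (recordDomSys F Mc k (recordK₀ F Mc k + n)).Dom → (Fin (recordBondCount F (recordK₀ F Mc k + (n + 1))) → ℂ) →
      (Fin (recordBondCount F (recordK₀ F Mc k + n)) → ℂ)}
    (hG : B12FormatPlus.FormatPlusG (fun n => recordDomSys F Mc k (recordK₀ F Mc k + n)) (fun n => recordBondCount F (recordK₀ F Mc k + n))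
      (fun n => recordAct F (recordK₀ F Mc k + n)) (fun n => recordUc F Mc k α₀ α₁ (recordK₀ F Mc k + n)) (fun n => recordCoords F Mc k (recordK₀ F Mc k + n))
      (fun n => recordChartDimJ F (recordK₀ F Mc k + n)) (fun n => recordChartJ F Mc k (recordK₀ F Mc k + n)) Φf ι wrap emb πc E₀ κ) :
    B12FormatPlus.FormatPlusW (fun n => recordDomSys F Mc k (recordK₀ F Mc k + n)) (fun n => recordBondCount F (recordK₀ F Mc k + n))
      (fun n => recordUc F Mc k α₀ α₁ (recordK₀ F Mc k + n)) (fun n => recordCoords F Mc k (recordK₀ F Mc k + n)) (fun n => recordChartDimJ F (recordK₀ F Mc k + n))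
      (fun n => recordChartJ F Mc k (recordK₀ F Mc k + n)) Φf ι wrap emb πc E₀ κ :=
  formatPlusW_of_formatPlusG_recordJ F Mc k (recordK₀ F Mc k) α₀ α₁ _ E₀ κ hG (K0PortChart44DAtRecord.chart44DJ_record F Mc k hα₀ hα₁)

/-- **★ The receipts form, chart discharged**: `FormatPlusGAtJ F Mc k a₀ ε₂₉ α₀ α₁ E₀ κ v → FormatPlusWAtJ F Mc k a₀ ε₂₉ α₀ α₁ E₀ κ v` for `0 < α₀`, `0 < α₁`
(DEF-1's receipt `Chart44DAtJ` holds by `K0PortChart44DAtRecord.chart44DAtJ_record`). [cite: Balaban1987RG1, (1.19) p.263, (4.14) p.284 (bookkeeping)] -/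
theorem formatPlusWAtJ_of_formatPlusGAtJ' (Mc k : ℕ) (a₀ ε₂₉ : ℝ) {α₀ α₁ : ℝ} (hα₀ : 0 < α₀) (hα₁ : 0 < α₁) (E₀ κ : ℝ) (v : Fin (k + 1) → ℝ)
    (hG : FormatPlusGAtJ F Mc k a₀ ε₂₉ α₀ α₁ E₀ κ v) : FormatPlusWAtJ F Mc k a₀ ε₂₉ α₀ α₁ E₀ κ v :=
  formatPlusWAtJ_of_formatPlusGAtJ F Mc k a₀ ε₂₉ α₀ α₁ _ E₀ κ v hG (K0PortChart44DAtRecord.chart44DAtJ_record F Mc k hα₀ hα₁)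

end Summit.QuantumFields.YangMills.Theorems.BalabanUVNodesPortS1

end
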